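import Mathlib
import HarnessLib
import Summits.Ventures.LatticeQCDFlow.Exactness.SUNResidualCouplingLayer
import Summits.Ventures.LatticeQCDFlow.Exactness.SUNStoutLayerEquivariance
import Summits.Ventures.LatticeQCDFlow.Exactness.EquivariantJacobianGaugeInvariance

/-!
# The engine's GENERAL residual coupling layer (stout / stout-defect / plaquette-potential) is gauge EQUIVARIANT, and its continuous exact Jacobians are class functions — every `N`

HONEST FRAMING: exact (Metropolis-corrected) sampling algorithms for lattice gauge theory;
figures of merit are autocorrelation/cost numbers at stated couplings and volumes; no
continuum-physics claim.

Venture `LatticeQCDFlow` (cell pub-lqcd), topic `Exactness`; FANOUT row 10 (`eng-equiv`, engine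
`latflow.equiv` `equiv/residual.py` `ResidualCoupling`: active links `u ↦ exp(Q(u)) u`,
`Q(u) = Σ_j g_j(c_j) A_j`, `A_j = −P(u C_j)`, `c_j = Re tr(u C_j)/N`, `g_j(c) = Σ_k a_{j,k} c^k`, the
staples `C_j` and coefficients `a_{j,k}` read from FROZEN links / a conditioner of gauge-invariant
frozen context; unit tests "gauge equivariance ≤ 4.4e-15", "log-det gauge invariance ≤ 8.9e-14").
NEW WORK of the cell.  `SUNStoutLayerEquivariance` typed the equivariance of the STOUT layer
(one loop sum `Ω`, one coefficient); this file types it for the engine's general residual coupling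
layer of `SUNResidualCouplingLayer` / `SUNEngineResidualLayerJacobian` — several staples per link,
polynomial weights — under the two structural hypotheses the engine's masks and conditioners
guarantee: each staple closes the active link into a loop based at its source,
`C_j(V^g|frozen) = g(x+μ̂) C_j(V|frozen) g(x)⋆`, and the coefficients are gauge invariant,
`a_{j,k}(V^g|frozen) = a_{j,k}(V|frozen)`.  Then, with `EquivariantJacobianGaugeInvariance`, every
continuous exact Jacobian of the layer is a class function.  Nothing is cited as a fact; no number;
no definition.

* `engineResidualExponent_unitary_conj` — the exponent transforms in the adjoint:
  `Q(g M g⋆) = g Q(M) g⋆` for unitary `g` (cyclic trace + `suProj_unitary_conj`);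
* `activeLink_mul_staple_gaugeTransform` — at an active link `(x, μ)`,
  `(V^g)(x,μ) · C_j(V^g|frozen) = g(x) (V(x,μ) C_j(V|frozen)) g(x)⋆`;
* **`isGaugeEquivariant_engineResidualCouplingLayer`** — the layer `Theory2.coupleFun p ψ_engine` is
  `IsGaugeEquivariant`, every `n`, `d`, `L`, mask `p`, degree `K`, staple set `σ`;
* **`isGaugeInvariant_jacobian_engineResidualCouplingLayer`** — with continuous staples /
  coefficients and the certificate `Σ_j Σ_{k<K} (1+k)|a_{j,k}| < 1` (so the layer is a measurable
  automorphism, `exists_measurableEquiv_engineResidualCouplingLayer`), every continuous `j ≥ 0` with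
  `HasJacobian (⊗_e Haar_{SU(n)}) (layer) (ofReal ∘ j)` is gauge invariant — in particular the `J` of
  `SUNEngineResidualLayerJacobian.hasJacobian_engineResidualCouplingLayer`.
-/

noncomputable section

namespace Summit.Ventures.LatticeQCDFlow.Exactness

open Literature.MathematicalPhysics.QuantumFieldTheory
open Literature.MathematicalPhysics.QuantumFieldTheory.Luscher2010
open Literature.MathematicalPhysics.QuantumFieldTheory.WilsonFlow
open MeasureTheory
open scoped Matrix ENNReal

variable {d L n : ℕ} {σ : Type*} [Fintype σ]

/-! ## The exponent transforms in the adjoint -/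

/-- **`Q(g M g⋆) = g Q(M) g⋆`** for the engine exponent
`Q(M) = Σ_j (Σ_{k<K} a_{jk} (Re tr M_j / n)^k) • (−P(M_j))` and unitary `g`. -/
theorem engineResidualExponent_unitary_conj (K : ℕ) (a : σ → ℕ → ℝ) (M : σ → Matrix (Fin n) (Fin n) ℂ)
    {g : Matrix (Fin n) (Fin n) ℂ} (hg : g ∈ Matrix.unitaryGroup (Fin n) ℂ) :
    (∑ j, ((∑ k ∈ Finset.range K, a j k * (((g * M j * star g).trace.re / n) ^ k) : ℝ) : ℂ) •
        (-suProj (g * M j * star g))) =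
      g * (∑ j, ((∑ k ∈ Finset.range K, a j k * (((M j).trace.re / n) ^ k) : ℝ) : ℂ) • (-suProj (M j))) *
        star g := by
  have h1 : star g * g = 1 := Matrix.mem_unitaryGroup_iff'.mp hg
  have htr : ∀ j, (g * M j * star g).trace = (M j).trace := fun j => by
    rw [Matrix.trace_mul_cycle, h1, Matrix.one_mul]
  rw [Finset.mul_sum, Finset.sum_mul]
  refine Finset.sum_congr rfl fun j _ => ?_
  rw [htr j, suProj_unitary_conj hg, Matrix.mul_smul, Matrix.smul_mul, Matrix.mul_neg, Matrix.neg_mul]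

variable [NeZero L]

omit [NeZero L] in
/-- **At an active link the (link · staple) products transform by conjugation at the source**:
if the staple closes the link `(x, μ)` into a loop based at `x`,
`C(V^g|frozen) = g(x+μ̂) C(V|frozen) g(x)⋆`, then `(V^g)(x,μ) C(V^g|frozen) = g(x) (V(x,μ) C(V|frozen)) g(x)⋆`. -/
theorem activeLink_mul_staple_gaugeTransform {p : Edge d L → Prop}
    (C : ({f : Edge d L // ¬p f} → Matrix.specialUnitaryGroup (Fin n) ℂ) → Matrix (Fin n) (Fin n) ℂ)
    (e : Edge d L) (g : Site d L → Matrix.specialUnitaryGroup (Fin n) ℂ)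
    (V : GaugeConfig d L (Matrix.specialUnitaryGroup (Fin n) ℂ))
    (hCg : C (fun f => gaugeTransform g V f) =
      ((g (e.1.shift e.2) : Matrix.specialUnitaryGroup (Fin n) ℂ) : Matrix (Fin n) (Fin n) ℂ) * C (fun f => V f) *
        star ((g e.1 : Matrix.specialUnitaryGroup (Fin n) ℂ) : Matrix (Fin n) (Fin n) ℂ)) :
    ((gaugeTransform g V e : Matrix.specialUnitaryGroup (Fin n) ℂ) : Matrix (Fin n) (Fin n) ℂ) *
        C (fun f => gaugeTransform g V f) =
      ((g e.1 : Matrix.specialUnitaryGroup (Fin n) ℂ) : Matrix (Fin n) (Fin n) ℂ) *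
        (((V e : Matrix.specialUnitaryGroup (Fin n) ℂ) : Matrix (Fin n) (Fin n) ℂ) * C (fun f => V f)) *
        star ((g e.1 : Matrix.specialUnitaryGroup (Fin n) ℂ) : Matrix (Fin n) (Fin n) ℂ) := by
  have hu : star ((g (e.1.shift e.2) : Matrix.specialUnitaryGroup (Fin n) ℂ) : Matrix (Fin n) (Fin n) ℂ) *
      ((g (e.1.shift e.2) : Matrix.specialUnitaryGroup (Fin n) ℂ) : Matrix (Fin n) (Fin n) ℂ) = 1 :=
    Matrix.mem_unitaryGroup_iff'.mp (g (e.1.shift e.2)).2.1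
  rw [hCg, gaugeTransform_apply, coe_mul_SU, coe_mul_SU, coe_inv_SU, ← Matrix.star_eq_conjTranspose]
  simp only [Matrix.mul_assoc]
  rw [← Matrix.mul_assoc (star ((g (e.1.shift e.2) : Matrix.specialUnitaryGroup (Fin n) ℂ) :
    Matrix (Fin n) (Fin n) ℂ)), hu, Matrix.one_mul]

/-! ## Gauge equivariance of the engine's residual coupling layer -/

omit [NeZero L] in
/-- **The engine's general residual coupling layer is gauge equivariant**, every `n`, `d`, `L`,
mask `p`, degree `K`, staple set: staples based at the source of the active link
(`C a j (V^g|frozen) = g(x+μ̂) C a j (V|frozen) g(x)⋆`) and gauge-invariant coefficients. -/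
theorem isGaugeEquivariant_engineResidualCouplingLayer (p : Edge d L → Prop) [DecidablePred p] (K : ℕ)
    (C : {e : Edge d L // p e} → σ → ({f : Edge d L // ¬p f} → Matrix.specialUnitaryGroup (Fin n) ℂ) →
      Matrix (Fin n) (Fin n) ℂ)
    (acoef : {e : Edge d L // p e} → σ → ℕ → ({f : Edge d L // ¬p f} → Matrix.specialUnitaryGroup (Fin n) ℂ) → ℝ)
    (hCg : ∀ (g : Site d L → Matrix.specialUnitaryGroup (Fin n) ℂ)
      (V : GaugeConfig d L (Matrix.specialUnitaryGroup (Fin n) ℂ)) (a : {e : Edge d L // p e}) (j : σ),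
      C a j (fun f => gaugeTransform g V f) =
        ((g (a.1.1.shift a.1.2) : Matrix.specialUnitaryGroup (Fin n) ℂ) : Matrix (Fin n) (Fin n) ℂ) *
          C a j (fun f => V f) * star ((g a.1.1 : Matrix.specialUnitaryGroup (Fin n) ℂ) : Matrix (Fin n) (Fin n) ℂ))
    (hag : ∀ (g : Site d L → Matrix.specialUnitaryGroup (Fin n) ℂ)
      (V : GaugeConfig d L (Matrix.specialUnitaryGroup (Fin n) ℂ)) (a : {e : Edge d L // p e}) (j : σ) (k : ℕ),
      acoef a j k (fun f => gaugeTransform g V f) = acoef a j k (fun f => V f)) :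
    IsGaugeEquivariant (Theory2.coupleFun p fun a y (u : Matrix.specialUnitaryGroup (Fin n) ℂ) =>
      (⟨NormedSpace.exp (∑ j, ((∑ k ∈ Finset.range K, acoef a j k y *
            (((u : Matrix (Fin n) (Fin n) ℂ) * C a j y).trace.re / n) ^ k : ℝ) : ℂ) •
          (-suProj ((u : Matrix (Fin n) (Fin n) ℂ) * C a j y))) * u,
        residual_value_mem (fun U _ => residualExponent_skew (fun j k => acoef a j k y) K
          (fun j => C a j y) U) u.2⟩ : Matrix.specialUnitaryGroup (Fin n) ℂ)) := by
  intro g V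
  funext e
  by_cases he : p e
  · rw [Theory2.coupleFun_apply_of_pos _ _ he, gaugeTransform_apply g (Theory2.coupleFun p _ V) e,
      Theory2.coupleFun_apply_of_pos _ _ he]
    apply Subtype.ext
    simp only [coe_mul_SU, coe_inv_SU]
    -- the exponent at the transformed configuration is the conjugate of the exponent
    have hM : ∀ j, ((gaugeTransform g V e : Matrix.specialUnitaryGroup (Fin n) ℂ) : Matrix (Fin n) (Fin n) ℂ) *
        C ⟨e, he⟩ j (fun f => gaugeTransform g V f) =
        ((g e.1 : Matrix.specialUnitaryGroup (Fin n) ℂ) : Matrix (Fin n) (Fin n) ℂ) *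
          (((V e : Matrix.specialUnitaryGroup (Fin n) ℂ) : Matrix (Fin n) (Fin n) ℂ) * C ⟨e, he⟩ j (fun f => V f)) *
          star ((g e.1 : Matrix.specialUnitaryGroup (Fin n) ℂ) : Matrix (Fin n) (Fin n) ℂ) :=
      fun j => activeLink_mul_staple_gaugeTransform (C ⟨e, he⟩ j) e g V (hCg g V ⟨e, he⟩ j)
    have hg : ((g e.1 : Matrix.specialUnitaryGroup (Fin n) ℂ) : Matrix (Fin n) (Fin n) ℂ) ∈
        Matrix.unitaryGroup (Fin n) ℂ := (g e.1).2.1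
    have hexp : NormedSpace.exp (∑ j, ((∑ k ∈ Finset.range K, acoef ⟨e, he⟩ j k (fun f => gaugeTransform g V f) *
          ((((gaugeTransform g V e : Matrix.specialUnitaryGroup (Fin n) ℂ) : Matrix (Fin n) (Fin n) ℂ) *
            C ⟨e, he⟩ j (fun f => gaugeTransform g V f)).trace.re / n) ^ k : ℝ) : ℂ) •
          (-suProj (((gaugeTransform g V e : Matrix.specialUnitaryGroup (Fin n) ℂ) : Matrix (Fin n) (Fin n) ℂ) *
            C ⟨e, he⟩ j (fun f => gaugeTransform g V f)))) =
        ((g e.1 : Matrix.specialUnitaryGroup (Fin n) ℂ) : Matrix (Fin n) (Fin n) ℂ) *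
          NormedSpace.exp (∑ j, ((∑ k ∈ Finset.range K, acoef ⟨e, he⟩ j k (fun f => V f) *
            ((((V e : Matrix.specialUnitaryGroup (Fin n) ℂ) : Matrix (Fin n) (Fin n) ℂ) *
              C ⟨e, he⟩ j (fun f => V f)).trace.re / n) ^ k : ℝ) : ℂ) •
            (-suProj (((V e : Matrix.specialUnitaryGroup (Fin n) ℂ) : Matrix (Fin n) (Fin n) ℂ) *
              C ⟨e, he⟩ j (fun f => V f)))) *
          star ((g e.1 : Matrix.specialUnitaryGroup (Fin n) ℂ) : Matrix (Fin n) (Fin n) ℂ) := by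
      simp_rw [hag g V ⟨e, he⟩, hM]
      rw [engineResidualExponent_unitary_conj K (fun j k => acoef ⟨e, he⟩ j k (fun f => V f))
        (fun j => ((V e : Matrix.specialUnitaryGroup (Fin n) ℂ) : Matrix (Fin n) (Fin n) ℂ) * C ⟨e, he⟩ j (fun f => V f)) hg,
        exp_conj_of_mem_specialUnitaryGroup (g e.1).2]
    rw [hexp, gaugeTransform_apply g V e, coe_mul_SU, coe_mul_SU, coe_inv_SU]
    have hu : star ((g e.1 : Matrix.specialUnitaryGroup (Fin n) ℂ) : Matrix (Fin n) (Fin n) ℂ) *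
        ((g e.1 : Matrix.specialUnitaryGroup (Fin n) ℂ) : Matrix (Fin n) (Fin n) ℂ) = 1 :=
      Matrix.mem_unitaryGroup_iff'.mp hg
    simp only [Matrix.mul_assoc]
    rw [← Matrix.mul_assoc (star ((g e.1 : Matrix.specialUnitaryGroup (Fin n) ℂ) : Matrix (Fin n) (Fin n) ℂ))
      ((g e.1 : Matrix.specialUnitaryGroup (Fin n) ℂ) : Matrix (Fin n) (Fin n) ℂ), hu, Matrix.one_mul]
  · rw [Theory2.coupleFun_apply_of_neg _ _ he, gaugeTransform_apply, gaugeTransform_apply,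
      Theory2.coupleFun_apply_of_neg _ _ he]

/-! ## Class functions: continuous exact Jacobians of the engine layer are gauge invariant -/

/-- **Every continuous exact Jacobian of the engine's residual coupling layer is gauge invariant**
(continuous staples and coefficients, certificate `Σ_j Σ_{k<K} (1+k)|a_{jk}| < 1`). -/
theorem isGaugeInvariant_jacobian_engineResidualCouplingLayer (p : Edge d L → Prop) [DecidablePred p] (K : ℕ)
    (C : {e : Edge d L // p e} → σ → ({f : Edge d L // ¬p f} → Matrix.specialUnitaryGroup (Fin n) ℂ) →
      Matrix (Fin n) (Fin n) ℂ)
    (hCu : ∀ a j y, C a j y ∈ Matrix.unitaryGroup (Fin n) ℂ) (hCc : ∀ a j, Continuous (C a j))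
    (acoef : {e : Edge d L // p e} → σ → ℕ → ({f : Edge d L // ¬p f} → Matrix.specialUnitaryGroup (Fin n) ℂ) → ℝ)
    (hac : ∀ a j k, Continuous (acoef a j k))
    (hκ : ∀ a y, ∑ j, ∑ k ∈ Finset.range K, (1 + (k : ℝ)) * |acoef a j k y| < 1)
    (hCg : ∀ (g : Site d L → Matrix.specialUnitaryGroup (Fin n) ℂ)
      (V : GaugeConfig d L (Matrix.specialUnitaryGroup (Fin n) ℂ)) (a : {e : Edge d L // p e}) (j : σ),
      C a j (fun f => gaugeTransform g V f) =
        ((g (a.1.1.shift a.1.2) : Matrix.specialUnitaryGroup (Fin n) ℂ) : Matrix (Fin n) (Fin n) ℂ) *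
          C a j (fun f => V f) * star ((g a.1.1 : Matrix.specialUnitaryGroup (Fin n) ℂ) : Matrix (Fin n) (Fin n) ℂ))
    (hag : ∀ (g : Site d L → Matrix.specialUnitaryGroup (Fin n) ℂ)
      (V : GaugeConfig d L (Matrix.specialUnitaryGroup (Fin n) ℂ)) (a : {e : Edge d L // p e}) (j : σ) (k : ℕ),
      acoef a j k (fun f => gaugeTransform g V f) = acoef a j k (fun f => V f))
    {j : GaugeConfig d L (Matrix.specialUnitaryGroup (Fin n) ℂ) → ℝ} (hj : Continuous j) (hj0 : ∀ U, 0 ≤ j U)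
    (h : HasJacobian (Measure.pi fun _ : Edge d L => haarProbability (Matrix.specialUnitaryGroup (Fin n) ℂ))
      (Theory2.coupleFun p fun a y (u : Matrix.specialUnitaryGroup (Fin n) ℂ) =>
        (⟨NormedSpace.exp (∑ j, ((∑ k ∈ Finset.range K, acoef a j k y *
              (((u : Matrix (Fin n) (Fin n) ℂ) * C a j y).trace.re / n) ^ k : ℝ) : ℂ) •
            (-suProj ((u : Matrix (Fin n) (Fin n) ℂ) * C a j y))) * u,
          residual_value_mem (fun U _ => residualExponent_skew (fun j k => acoef a j k y) K
            (fun j => C a j y) U) u.2⟩ : Matrix.specialUnitaryGroup (Fin n) ℂ))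
      (fun U => ENNReal.ofReal (j U))) :
    IsGaugeInvariant j := by
  haveI : SecondCountableTopology (Matrix (Fin n) (Fin n) ℂ) :=
    inferInstanceAs (SecondCountableTopology (Fin n → Fin n → ℂ))
  haveI : SecondCountableTopology (Matrix.specialUnitaryGroup (Fin n) ℂ) :=
    Topology.IsEmbedding.subtypeVal.secondCountableTopology
  obtain ⟨Ψ, hΨ⟩ := exists_measurableEquiv_engineResidualCouplingLayer (p := p) K C hCu hCc acoef hac hκ
  have hequiv : IsGaugeEquivariant (Ψ : GaugeConfig d L (Matrix.specialUnitaryGroup (Fin n) ℂ) →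
      GaugeConfig d L (Matrix.specialUnitaryGroup (Fin n) ℂ)) := by
    rw [hΨ]
    exact isGaugeEquivariant_engineResidualCouplingLayer p K C acoef hCg hag
  rw [← hΨ] at h
  exact isGaugeInvariant_of_hasJacobian hequiv hj hj0 h

end Summit.Ventures.LatticeQCDFlow.Exactness

end
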